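import Literature.NumberTheory.Rogawski1990.MatchingAdeleGKConjSemisimple
import Literature.NumberTheory.Rogawski1990.LocalTransfer
import HarnessLib

/-!
# The unramified local STABLE unit factor `Φ^st_v(γ_v, 1_{K_v}) = 1` a.e. at a SEMISIMPLE (possibly SINGULAR) rational class: the own class gives `1`,
# every other class of the local stable class misses `K_v`
(Kottwitz, *Stable trace formula: elliptic singular terms* (1986), Prop. 7.1, Cor. 7.3; Rogawski, *Automorphic Representations of Unitary Groups in Three
Variables* (1990), §3.3 p. 21, §4.3 p. 44, §4.9 p. 54 «`Δ_{G∕H} = +1` for almost all `v`», §8.2 Prop. 8.2.1 (b))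

Topic `NumberTheory/Rogawski1990`; namespaces `Literature.NumberTheory.Automorphic` (§1, generic) and `Literature.NumberTheory.Rogawski1990` (§2–§3).  THEOREMS ONLY:
no definition, no instance, no notation, no named fact, no `sorry`.  Cell `pub/hodgecm-mathlib`, FLOOR-0 programme P3a, the «#88 side» (pay-down of ★
`Rogawski1990.SingularEllipticTransferCanonical`, LEAD DESK WORDS T6-18∕T6-20), `CENSUS-88-kappaMass` (F0P3a-p08 (g9)) §4 **P4**: the in-house half of print's
«the constant of the singular κ-identity is `1` at almost every place».  The STABLE twin of ★ `UnitaryGroup.eventually_classOrbitalIntegral_indicator_eq_one_of_integralConj`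
(`Automorphic/UnramifiedOrbitalUnitFactorSemisimple` :299 — the OWN class `⟦γ_v⟧`), now for the whole local stable class ★ `localStableOrbitalIntegral`
(`Rogawski1990/LocalTransfer` :481: `Σ_{c : γ_v ~_st out c} Φ_{m v}(c, f)`).

THE POINT.  At a singular semisimple `γ_v` the local stable class `{c | γ_v ~_st out c}` has several `U(H)(L⁺_v)`-classes (two at an inert place for the
`U(W₂) × U(1)`-type centralisers).  For the unit `1_{K_v}` only the OWN class contributes, for almost every `v`: a point `y (out c) y⁻¹ ∈ K_v` of the orbit of another
class `c` would be `GL_N`-conjugate to `γ_v` (stable conjugacy IS `GL_N`-conjugacy, ★ `IsStablyConj`), hence `K_v`-conjugate to `γ_v` by Kottwitz's lemma in its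
`K_v`-CONJUGACY form (KC) — forcing `c = ⟦γ_v⟧`.  So the `1_{K_v}`-orbital integrand of every other class vanishes identically, the stable sum collapses to its
own-class term by `finsum_eq_single` (NO finiteness of the local stable class is needed), and that term is `1` by ★ :299 under the normalisation ★ `IsNormalisedOff`.

* §1 `classOrbitalIntegral_eq_zero_of_forall_conj_eq_zero` — a class orbital integral of a function vanishing on the whole orbit is `0` (any measure).
* §2 **`eventually_localStableOrbitalIntegral_indicator_eq_one_of_integralConj`** (any `N`, any `H`; binders VERBATIM as ★ :299: the (KC) clause `hKγ` at the
  rational `γ`, invariance of `mG v ⟦γ_v⟧`, `IsNormalisedOff L N H mG (γ ⊗ 1) S₀`): `∀ᶠ v in cofinite, localStableOrbitalIntegral L N H v (mG v) 1_{K_v} γ_v = 1`;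
  and `localStableOrbitalIntegral_indicator_eq_classOrbitalIntegral_of_integralConj` (the pointwise collapse at a place where (KC) holds).
* §3 **`eventually_localStableOrbitalIntegral_indicator_eq_one_of_isSemisimpleElt`** (`N = 3`, `H` hermitian with `det H ≠ 0`, `γ` semisimple — regular,
  singular or central alike): (KC) discharged by ★ FILE 3 `eventually_forall_integralConj_cmDatum_of_isSemisimpleElt` (`MatchingAdeleGKConjSemisimple` :106).
Consumer: the T6-L5 ED. 2 payable P4 `stub_kappaConst_ae_one` (evaluate the (κ-loc) letter at the unit pair `(1_{K_H}, 1_{K′})`: its left side is this lemma's `1`).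
HC_CM is proved only modulo the printed citations until rung 0 closes; this file consumes nothing printed.

## References
* [Kottwitz1986] R. E. Kottwitz, *Stable trace formula: elliptic singular terms*, Math. Ann. 275 (1986), §7, Prop. 7.1, Cor. 7.3.
* [Rogawski1990] J. D. Rogawski, *Automorphic Representations of Unitary Groups in Three Variables*, Ann. of Math. Stud. 123 (1990), §3.3 p. 21, §4.3 p. 44,
  §4.9 p. 54, §8.2 Prop. 8.2.1 p. 117.
-/

set_option autoImplicit false

noncomputable section

open MeasureTheory Measure Set Filter Topology NumberField IsDedekindDomain
open scoped ENNReal NNReal Pointwise Matrix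

/-! ## §1 A class orbital integral of a function vanishing on the orbit is zero -/

namespace Literature.NumberTheory.Automorphic

section Vanish

variable {G : Type*} [Group G] [∀ g : G, MeasurableSpace (G ⧸ Subgroup.centralizer ({g} : Set G))]
  {E : Type*} [NormedAddCommGroup E] [NormedSpace ℝ E]

/-- **`Φ_m(c, f) = 0` when `f` vanishes on the whole orbit of `out c`** (the orbital integrand `ȳ ↦ f(y (out c) y⁻¹)` is identically `0`; any measure, no
integrability). [cite: Rogawski1990, §4.9 p. 54] -/
theorem classOrbitalIntegral_eq_zero_of_forall_conj_eq_zero (m : OrbitalMeasureFamily G) (f : G → E) (c : ConjClasses G)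
    (h : ∀ y : G, f (y * Quotient.out c * y⁻¹) = 0) : classOrbitalIntegral m f c = 0 := by
  rw [classOrbitalIntegral_eq, orbitalIntegral_eq_integral_descConj]
  have hzero : Literature.MeasureTheory.Group.descConj (Quotient.out c : G) (Subgroup.centralizer ({(Quotient.out c : G)} : Set G))
      (fun _ hg => Subgroup.mem_centralizer_singleton_iff.1 hg) f = 0 := by
    funext y
    induction y using QuotientGroup.induction_on with
    | H g => exact h g
  rw [hzero, Pi.zero_def, integral_zero]

end Vanish

end Literature.NumberTheory.Automorphic

namespace Literature.NumberTheory.Rogawski1990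

open Literature.NumberTheory.Automorphic Literature.NumberTheory.Automorphic.UnitaryGroup Literature.MeasureTheory.Group
open Literature.AlgebraicGeometry.ShimuraVarieties (unitaryGroup)

/-! ## §2 The stable unit factor from the `K_v`-conjugacy clause (KC) at a rational `γ` -/

section StableUnitFactor

variable (L : Type) [Field L] [NumberField L] [IsCMField L] (N : ℕ) (H : Matrix (Fin N) (Fin N) L)
  [∀ (v : HeightOneSpectrum (𝓞 ↥(maximalRealSubfield L))) (x : (cmDatum L N H).Local v),
    MeasurableSpace ((cmDatum L N H).Local v ⧸ Subgroup.centralizer ({x} : Set ((cmDatum L N H).Local v)))]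
  [∀ (v : HeightOneSpectrum (𝓞 ↥(maximalRealSubfield L))) (x : (cmDatum L N H).Local v),
    BorelSpace ((cmDatum L N H).Local v ⧸ Subgroup.centralizer ({x} : Set ((cmDatum L N H).Local v)))]
  (mG : ∀ v : HeightOneSpectrum (𝓞 ↥(maximalRealSubfield L)), OrbitalMeasureFamily ((cmDatum L N H).Local v))

omit [∀ (v : HeightOneSpectrum (𝓞 ↥(maximalRealSubfield L))) (x : (cmDatum L N H).Local v),
    BorelSpace ((cmDatum L N H).Local v ⧸ Subgroup.centralizer ({x} : Set ((cmDatum L N H).Local v)))] in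
/-- **At a place where (KC) holds, the `1_{K_v}`-stable orbital integral at `γ_v` is its own-class term**: every OTHER class `c` with `γ_v ~_st out c`
has an orbit missing `K_v` — a point `y (out c) y⁻¹ ∈ K_v` is `GL_N`-conjugate to `γ_v`, hence `K_v`-conjugate to it by (KC), so `out c ~ γ_v` in `U(H)(L⁺_v)` and
`c = ⟦γ_v⟧` — and `finsum_eq_single` collapses the stable sum (no finiteness needed). [cite: Kottwitz1986, Prop. 7.1] [cite: Rogawski1990, §3.3 p. 21; §4.3 p. 44] -/
theorem localStableOrbitalIntegral_indicator_eq_classOrbitalIntegral_of_integralConj (γ : (cmDatum L N H).Rational)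
    (v : HeightOneSpectrum (𝓞 ↥(maximalRealSubfield L)))
    (hv : ∀ g' : (cmDatum L N H).Local v, g' ∈ cmLocalIntegralLevel L N H v →
        IsConj (g'.val : GL (Fin N) (LocalRing L v))
          (((cmDatum L N H).toLocal v ((cmDatum L N H).toAdelic γ)).val : GL (Fin N) (LocalRing L v)) →
          ∃ k ∈ cmLocalIntegralLevel L N H v, k * (cmDatum L N H).toLocal v ((cmDatum L N H).toAdelic γ) * k⁻¹ = g') :
    localStableOrbitalIntegral L N H v (mG v) ((cmLocalIntegralLevel L N H v : Set ((cmDatum L N H).Local v)).indicator fun _ => (1 : ℂ))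
        ((cmDatum L N H).toLocal v ((cmDatum L N H).toAdelic γ)) =
      classOrbitalIntegral (mG v) ((cmLocalIntegralLevel L N H v : Set ((cmDatum L N H).Local v)).indicator fun _ => (1 : ℂ))
        (ConjClasses.mk ((cmDatum L N H).toLocal v ((cmDatum L N H).toAdelic γ))) := by
  set γv := (cmDatum L N H).toLocal v ((cmDatum L N H).toAdelic γ) with hγv
  rw [localStableOrbitalIntegral, stableOrbitalIntegralRel_def, finsum_mem_def]
  rw [finsum_eq_single _ (ConjClasses.mk γv)]
  · exact Set.indicator_of_mem (show ConjClasses.mk γv ∈ {c : ConjClasses ((cmDatum L N H).Local v) |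
        IsStablyConj (conjLocal L (IsCMField.complexConj L) v) ((adelicForm L N H).map (adeleToLocal L v)) γv (Quotient.out c)} from
      isStablyConj_of_isConj (isConj_out_conjClasses_mk γv)) _
  · intro c hc
    by_cases hcS : c ∈ {c : ConjClasses ((cmDatum L N H).Local v) |
        IsStablyConj (conjLocal L (IsCMField.complexConj L) v) ((adelicForm L N H).map (adeleToLocal L v)) γv (Quotient.out c)}
    · refine (Set.indicator_of_mem hcS _).trans ?_
      -- the `1_{K_v}`-integrand vanishes on the orbit of `out c`
      refine classOrbitalIntegral_eq_zero_of_forall_conj_eq_zero (mG v) _ c fun y => Set.indicator_of_notMem ?_ _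
      intro hyK
      apply hc
      -- `y (out c) y⁻¹ ∈ K_v` is `GL_N`-conjugate to `γ_v`: stably conjugate to `out c`, which is stably conjugate to `γ_v`
      have hst : IsStablyConj (conjLocal L (IsCMField.complexConj L) v) ((adelicForm L N H).map (adeleToLocal L v)) γv (Quotient.out c) := hcS
      have hconj : IsConj ((y * Quotient.out c * y⁻¹ : (cmDatum L N H).Local v).val : GL (Fin N) (LocalRing L v)) (γv.val : GL (Fin N) (LocalRing L v)) :=
        ((((«local» L (IsCMField.complexConj L) N H v).subtype.map_isConj (isConj_iff.2 ⟨y, rfl⟩)).symm.trans hst.symm))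
      obtain ⟨k, -, hk⟩ := hv _ hyK hconj
      -- hence `out c` is `U(H)(L⁺_v)`-conjugate to `γ_v`
      have hcj : IsConj γv (Quotient.out c : (cmDatum L N H).Local v) := by
        refine isConj_iff.2 ⟨y⁻¹ * k, ?_⟩
        calc y⁻¹ * k * γv * (y⁻¹ * k)⁻¹ = y⁻¹ * (k * γv * k⁻¹) * y := by group
          _ = y⁻¹ * (y * Quotient.out c * y⁻¹) * y := by rw [hk]
          _ = Quotient.out c := by group
      rw [← Quotient.out_eq c]
      exact (ConjClasses.mk_eq_mk_iff_isConj.2 hcj).symm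
    · exact Set.indicator_of_notMem hcS _

/-- **THE UNRAMIFIED STABLE UNIT FACTOR `Φ^st_v(γ_v, 1_{K_v}) = 1` a.e.** at ANY rational `γ` satisfying the (KC) clause a.e. (★ K6-α at semisimple `γ`), for local
families invariant at `⟦γ_v⟧` and normalised at `γ ⊗ 1` off `S₀` (★ `IsNormalisedOff`): the own class gives `1` (★ `eventually_classOrbitalIntegral_indicator_eq_one_of_integralConj`),
the other classes of the local stable class give `0` (previous lemma).  This is how print's «`+1` for almost all `v`» (§4.9 p. 54) is read on the singular side of
Prop. 8.2.1: the unit pair evaluates the singular κ-identity's constant to `1`. [cite: Kottwitz1986, Prop. 7.1, Cor. 7.3] [cite: Rogawski1990, §4.3 p. 44; §4.9 p. 54] -/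
theorem eventually_localStableOrbitalIntegral_indicator_eq_one_of_integralConj (γ : (cmDatum L N H).Rational)
    (hKγ : ∀ᶠ v : HeightOneSpectrum (𝓞 ↥(maximalRealSubfield L)) in Filter.cofinite,
      ∀ g' : (cmDatum L N H).Local v, g' ∈ cmLocalIntegralLevel L N H v →
        IsConj (g'.val : GL (Fin N) (LocalRing L v))
          (((cmDatum L N H).toLocal v ((cmDatum L N H).toAdelic γ)).val : GL (Fin N) (LocalRing L v)) →
          ∃ k ∈ cmLocalIntegralLevel L N H v, k * (cmDatum L N H).toLocal v ((cmDatum L N H).toAdelic γ) * k⁻¹ = g')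
    (hinv : ∀ v, SMulInvariantMeasure ((cmDatum L N H).Local v) _
      (mG v (ConjClasses.mk ((cmDatum L N H).toLocal v ((cmDatum L N H).toAdelic γ)))))
    {S₀ : Finset (HeightOneSpectrum (𝓞 ↥(maximalRealSubfield L)))} (hS₀ : IsNormalisedOff L N H mG ((cmDatum L N H).toAdelic γ) S₀) :
    ∀ᶠ v : HeightOneSpectrum (𝓞 ↥(maximalRealSubfield L)) in Filter.cofinite,
      localStableOrbitalIntegral L N H v (mG v) ((cmLocalIntegralLevel L N H v : Set ((cmDatum L N H).Local v)).indicator fun _ => (1 : ℂ))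
          ((cmDatum L N H).toLocal v ((cmDatum L N H).toAdelic γ)) = 1 := by
  filter_upwards [hKγ, eventually_classOrbitalIntegral_indicator_eq_one_of_integralConj L N H mG γ hKγ hinv hS₀] with v hv h1
  rw [localStableOrbitalIntegral_indicator_eq_classOrbitalIntegral_of_integralConj L N H mG γ v hv, h1]

end StableUnitFactor

/-! ## §3 `N = 3`: (KC) is a theorem at every semisimple rational class -/

section Semisimple

variable (L : Type) [Field L] [NumberField L] [IsCMField L] (H : Matrix (Fin 3) (Fin 3) L)
  [∀ (v : HeightOneSpectrum (𝓞 ↥(maximalRealSubfield L))) (x : (cmDatum L 3 H).Local v),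
    MeasurableSpace ((cmDatum L 3 H).Local v ⧸ Subgroup.centralizer ({x} : Set ((cmDatum L 3 H).Local v)))]
  [∀ (v : HeightOneSpectrum (𝓞 ↥(maximalRealSubfield L))) (x : (cmDatum L 3 H).Local v),
    BorelSpace ((cmDatum L 3 H).Local v ⧸ Subgroup.centralizer ({x} : Set ((cmDatum L 3 H).Local v)))]
  (mG : ∀ v : HeightOneSpectrum (𝓞 ↥(maximalRealSubfield L)), OrbitalMeasureFamily ((cmDatum L 3 H).Local v))

/-- **`Φ^st_v(γ_v, 1_{K_v}) = 1` for almost all `v` at EVERY SEMISIMPLE rational `γ ∈ U(H)(L⁺)`** (`H ∈ M₃(L)` hermitian, `det H ≠ 0`; regular, singular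
non-central and central `γ` alike), for local families invariant at `⟦γ_v⟧` and normalised at `γ ⊗ 1` off a finite set: §2 with (KC) supplied by ★
`eventually_forall_integralConj_cmDatum_of_isSemisimpleElt`. [cite: Kottwitz1986, Prop. 7.1, Cor. 7.3] [cite: Rogawski1990, §3.3 p. 21; §4.3 p. 44; §4.9 p. 54] -/
theorem eventually_localStableOrbitalIntegral_indicator_eq_one_of_isSemisimpleElt (hH : (H.map (cmConjRingHom L))ᵀ = H) (hHd : H.det ≠ 0)
    (γ : (cmDatum L 3 H).Rational) (hγ : IsSemisimpleElt (cmConjRingHom L) H γ)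
    (hinv : ∀ v, SMulInvariantMeasure ((cmDatum L 3 H).Local v) _
      (mG v (ConjClasses.mk ((cmDatum L 3 H).toLocal v ((cmDatum L 3 H).toAdelic γ)))))
    {S₀ : Finset (HeightOneSpectrum (𝓞 ↥(maximalRealSubfield L)))} (hS₀ : IsNormalisedOff L 3 H mG ((cmDatum L 3 H).toAdelic γ) S₀) :
    ∀ᶠ v : HeightOneSpectrum (𝓞 ↥(maximalRealSubfield L)) in Filter.cofinite,
      localStableOrbitalIntegral L 3 H v (mG v) ((cmLocalIntegralLevel L 3 H v : Set ((cmDatum L 3 H).Local v)).indicator fun _ => (1 : ℂ))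
          ((cmDatum L 3 H).toLocal v ((cmDatum L 3 H).toAdelic γ)) = 1 :=
  eventually_localStableOrbitalIntegral_indicator_eq_one_of_integralConj L 3 H mG γ
    (eventually_forall_integralConj_cmDatum_of_isSemisimpleElt L H hH hHd γ hγ) hinv hS₀

end Semisimple

end Literature.NumberTheory.Rogawski1990

end
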